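import Mathlib

/-!
# `stub_tangencySets`: the projective dictionary, trace coordinates, and the cyclic (Singer) unital substitute

Wall-breaker axis "Hermitian unital constructions" (k7/12) for the stub `stub_tangencySets` of the
crux `LevelOneGL2Designs` (stmt-MatrixMultiplication-14080, route LevelGradedCohnUmans).

The stub counts flags of the AFFINE plane over `ZMod p` in the normal form `f.1 ⬝ᵥ f'.2 = 1 ↔ f = f'`
(non-zero points, origin-avoiding lines), whereas the unital and every one of its prime-field
substitutes — above all the cyclic / Singer-invariant systems of the siege plan
(`Cruxes/LevelOneGL2Designs/DECOMPOSITIONS.md` §2.U1–U2, which hold the records `SRS(7) = 19`,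
`SRS(11) ≥ 35`) — live in the PROJECTIVE plane.  This file is the dictionary:

* `stub_srs_of_projective_srs` — projective flags `(x_i, l_i)` (`l_i ⬝ᵥ x_j = 0 ↔ i = j`,
  coordinate vectors in `F³`) give `|ι| - 2` flags in the stub's normal form: chart with the tangent
  `l_{i₀}` at infinity and the point `x_{i₁}` at the origin (`exists_pair_orth` supplies the frame);
  `projective_srs_of_stub_srs` — the converse embedding loses nothing.  Hence
  `SRS(q) - 2 ≤ T(q) ≤ SRS(q)` for the projective / affine maxima (tight at `q = 3, 5, 7`).
* `stub_srs_of_traceFlags` — the same for `PG(2,F) = ℙ_F(L)`, `[L:F] = 3`, with lines the kernels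
  of `Tr_{L/F}(λ ·)`: the coordinates in which cyclic systems are written.
* `stub_srs_of_singer` — the ONE-COSET CRITERION: a finite subgroup `K ≤ Lˣ` and `μ` with
  `Tr(μ w) = 0 ↔ w = 1` on `K` give `|K| - 2` stub flags (the `K`-orbit of one flag).  This is the
  exact sense in which "Singer orbits" substitute for the unital over prime fields: the unital is the
  orbit of a flag under `PGU(3,r)`; over `ZMod p` the only flag-regular cyclic candidates are the
  Singer subgroups of order `m ∣ p²+p+1`, and the criterion asks a coset to meet the trace-zero plane
  in exactly one point — an alignment of `≈ √p` cubic Gauss-sum phases, known to happen at `p = 7`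
  (`m = 19`, ISW-tight) and sporadically, which is why the axis files it as a witness generator.

What is NOT here: no existence statement for Singer data (that is arithmetic, checked instance by
instance by the certificate seats), and no bound — the unital bound is `…StubTangencySetsUnitalBound*`.
Elementary linear algebra (`basisOfLinearIndependentOfCardEqFinrank`, `Module.finBasisOfFinrankEq`,
`Algebra.trace`); no definitions.
-/

-- `Summit.MatrixMultiplication.MatrixMultiplication.…` is the tree's mandated summit/problem namespace (D-0017).
set_option linter.dupNamespace false

namespace Summit.MatrixMultiplication.MatrixMultiplication.Theorems.LevelOneGL2Designs.ProjectiveChart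

open Finset Matrix

variable {F : Type*} [Field F]

/-- Two linearly independent vectors orthogonal to a non-zero `w ∈ F³`. [elementary] -/
theorem exists_pair_orth (w : Fin 3 → F) (hw : w ≠ 0) :
    ∃ r₁ r₂ : Fin 3 → F, r₁ ⬝ᵥ w = 0 ∧ r₂ ⬝ᵥ w = 0 ∧
      ∀ α β : F, α • r₁ + β • r₂ = 0 → α = 0 ∧ β = 0 := by
  by_cases h0 : w 0 = 0
  · by_cases h1 : w 1 = 0
    · have h2 : w 2 ≠ 0 := by
        intro h2
        apply hw
        funext i
        fin_cases i
        · exact h0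
        · exact h1
        · exact h2
      refine ⟨![1, 0, 0], ![0, 1, 0], ?_, ?_, ?_⟩
      · rw [vec3_dotProduct]; simp [h0]
      · rw [vec3_dotProduct]; simp [h1]
      · intro α β h
        have e0 := congrFun h 0
        have e1 := congrFun h 1
        simp at e0 e1
        exact ⟨e0, e1⟩
    · refine ⟨![1, 0, 0], ![0, w 2, -w 1], ?_, ?_, ?_⟩
      · rw [vec3_dotProduct]; simp [h0]
      · rw [vec3_dotProduct]; simp; ring
      · intro α β h
        have e0 := congrFun h 0
        have e2 := congrFun h 2
        simp at e0 e2
        exact ⟨e0, e2.resolve_right h1⟩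
  · refine ⟨![w 1, -w 0, 0], ![w 2, 0, -w 0], ?_, ?_, ?_⟩
    · rw [vec3_dotProduct]; simp; ring
    · rw [vec3_dotProduct]; simp; ring
    · intro α β h
      have e1 := congrFun h 1
      have e2 := congrFun h 2
      simp at e1 e2
      exact ⟨e1.resolve_right h0, e2.resolve_right h0⟩

/-- **Projective flags give flags in the stub's normal form, losing two.**  Let
`(x_i, l_i)_{i ∈ ι}` be point/line coordinate vectors of `PG(2,F)` with `l_i ⬝ᵥ x_j = 0 ↔ i = j`
(a strong representative system of the projective plane: each point lies on its own line and on
no other).  Then there is an `S ⊆ F² × F²` with the stub's property `f.1 ⬝ᵥ f'.2 = 1 ↔ f = f'` and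
`|ι| ≤ |S| + 2`.  Chart: take the tangent `l_{i₀}` as the line at infinity and the point `x_{i₁}`
as the origin (new coordinates `(l_{i₀} ⬝ᵥ ·, r₁ ⬝ᵥ ·, r₂ ⬝ᵥ ·)` with `r₁, r₂ ⊥ x_{i₁}`, line
coordinates in the dual basis); exactly the flags `i₀` (point at infinity) and `i₁` (line through
the origin) are lost, and `aᵢ ⬝ᵥ bⱼ = 1 ↔ Lⱼ ⬝ᵥ Xᵢ = 0`.  So `T(q) ≥ SRS(q) - 2` for the affine /
projective maxima (equality at `q = 3, 5, 7`: `4 = 6-2`, `10 = 12-2`, `17 = 19-2`). [folklore] -/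
theorem stub_srs_of_projective_srs [DecidableEq F] {ι : Type*} [Fintype ι] [DecidableEq ι]
    (x l : ι → Fin 3 → F) (h : ∀ i j, l i ⬝ᵥ x j = 0 ↔ i = j) :
    ∃ S : Finset ((Fin 2 → F) × (Fin 2 → F)), Fintype.card ι ≤ S.card + 2 ∧
      ∀ f ∈ S, ∀ f' ∈ S, (f.1 ⬝ᵥ f'.2 = 1 ↔ f = f') := by
  classical
  by_cases hsmall : Fintype.card ι ≤ 2
  · exact ⟨∅, by simpa using hsmall, by simp⟩
  obtain ⟨i₀, i₁, hne⟩ : ∃ i₀ i₁ : ι, i₀ ≠ i₁ := by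
    by_contra hc
    push Not at hc
    have : Fintype.card ι ≤ 1 := Fintype.card_le_one_iff.2 hc
    omega
  have hc : l i₀ ⬝ᵥ x i₁ ≠ 0 := fun h0 => hne ((h i₀ i₁).1 h0)
  have hw : x i₁ ≠ 0 := by
    intro hw0
    apply hc
    rw [hw0, dotProduct_zero]
  obtain ⟨r₁, r₂, hr₁, hr₂, hind⟩ := exists_pair_orth (x i₁) hw
  -- the new coordinate rows and their linear independence
  let R : Fin 3 → (Fin 3 → F) := ![l i₀, r₁, r₂]
  have hR : LinearIndependent F R := by
    rw [Fintype.linearIndependent_iff]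
    intro g hg
    have hsum : g 0 • l i₀ + g 1 • r₁ + g 2 • r₂ = 0 := by
      simpa [R, Fin.sum_univ_three, add_assoc] using hg
    have h0 : g 0 = 0 := by
      have := congrArg (fun v => v ⬝ᵥ x i₁) hsum
      simp only [add_dotProduct, smul_dotProduct, smul_eq_mul, hr₁, hr₂, mul_zero, add_zero,
        zero_dotProduct] at this
      exact (mul_eq_zero.1 this).resolve_right hc
    have h12 : g 1 = 0 ∧ g 2 = 0 := by
      apply hind
      rw [h0, zero_smul, zero_add] at hsum
      exact hsum
    intro i
    fin_cases i
    · exact h0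
    · exact h12.1
    · exact h12.2
  have hcard3 : Fintype.card (Fin 3) = Module.finrank F (Fin 3 → F) := by simp
  let B : Module.Basis (Fin 3) F (Fin 3 → F) := basisOfLinearIndependentOfCardEqFinrank hR hcard3
  have hB : ∀ k, B k = R k := fun k => by simp [B]
  let Rm : Matrix (Fin 3) (Fin 3) F := Matrix.of R
  -- new point coordinates `X j = Rm *ᵥ x j`, new line coordinates `L j = B.repr (l j)`
  let X : ι → Fin 3 → F := fun j => Rm *ᵥ x j
  let L : ι → Fin 3 → F := fun j => B.repr (l j)
  have hl : ∀ j, l j = L j ᵥ* Rm := by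
    intro j
    have h1 : l j = ∑ k, (B.repr (l j)) k • B k := (B.sum_repr (l j)).symm
    rw [h1]
    ext m
    simp only [vecMul, dotProduct, Finset.sum_apply, Pi.smul_apply, smul_eq_mul, hB, Rm, of_apply,
      L]
  have hLX : ∀ i j, L i ⬝ᵥ X j = l i ⬝ᵥ x j := by
    intro i j
    show L i ⬝ᵥ (Rm *ᵥ x j) = l i ⬝ᵥ x j
    rw [dotProduct_mulVec, ← hl i]
  have hX0 : ∀ j, X j 0 = l i₀ ⬝ᵥ x j := by
    intro j
    show (Rm *ᵥ x j) 0 = l i₀ ⬝ᵥ x j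
    simp [mulVec, Rm, R]
  have hX1 : X i₁ 1 = 0 := by
    show (Rm *ᵥ x i₁) 1 = 0
    simp [mulVec, Rm, R, hr₁]
  have hX2 : X i₁ 2 = 0 := by
    show (Rm *ᵥ x i₁) 2 = 0
    simp [mulVec, Rm, R, hr₂]
  -- which flags are lost
  have hinf : ∀ j, X j 0 = 0 ↔ j = i₀ := by
    intro j
    rw [hX0, h i₀ j]
    exact eq_comm
  have hL0 : ∀ j, L j 0 = 0 ↔ j = i₁ := by
    intro j
    have h1 : L j ⬝ᵥ X i₁ = L j 0 * X i₁ 0 := by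
      rw [vec3_dotProduct, hX1, hX2, mul_zero, mul_zero, add_zero, add_zero]
    have h2 : X i₁ 0 ≠ 0 := by rw [hX0]; exact hc
    rw [← h j i₁, ← hLX, h1, mul_eq_zero, or_iff_left h2]
  -- the affine flags
  let A : ι → Fin 2 → F := fun j => ![X j 1 / X j 0, X j 2 / X j 0]
  let Bv : ι → Fin 2 → F := fun j => ![-(L j 1) / L j 0, -(L j 2) / L j 0]
  have hkey : ∀ j m, j ≠ i₀ → m ≠ i₁ → (A j ⬝ᵥ Bv m = 1 ↔ m = j) := by
    intro j m hj hm
    have hx : X j 0 ≠ 0 := fun h0 => hj ((hinf j).1 h0)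
    have hlm : L m 0 ≠ 0 := fun h0 => hm ((hL0 m).1 h0)
    rw [← h m j, ← hLX]
    simp only [A, Bv, vec2_dotProduct, vec3_dotProduct, Matrix.cons_val_zero, Matrix.cons_val_one,
      Matrix.cons_val_fin_one]
    constructor
    · intro h1
      field_simp at h1
      linear_combination -h1
    · intro h1
      field_simp
      linear_combination -h1
  let G := univ.filter fun j : ι => j ≠ i₀ ∧ j ≠ i₁
  have hGcard : G.card + 2 = Fintype.card ι := by
    have hG : G = (univ.erase i₀).erase i₁ := by
      ext j
      simp only [G, mem_filter, mem_univ, true_and, mem_erase]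
      tauto
    rw [hG, card_erase_of_mem (mem_erase.2 ⟨fun h => hne h.symm, mem_univ _⟩),
      card_erase_of_mem (mem_univ _), card_univ]
    omega
  have hinjG : Set.InjOn (fun j => (A j, Bv j)) (G : Set ι) := by
    intro j hj m hm hjm
    rw [mem_coe] at hj hm
    have hj' := (mem_filter.1 hj).2
    have hm' := (mem_filter.1 hm).2
    have h1 : A j ⬝ᵥ Bv j = 1 := (hkey j j hj'.1 hj'.2).2 rfl
    have h2 : Bv j = Bv m := congrArg Prod.snd hjm
    rw [h2] at h1
    exact ((hkey j m hj'.1 hm'.2).1 h1).symm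
  refine ⟨G.image fun j => (A j, Bv j), ?_, ?_⟩
  · rw [card_image_of_injOn hinjG]
    omega
  · simp only [mem_image]
    rintro f ⟨j, hj, rfl⟩ f' ⟨m, hm, rfl⟩
    have hj' := (mem_filter.1 hj).2
    have hm' := (mem_filter.1 hm).2
    rw [hkey j m hj'.1 hm'.2]
    constructor
    · rintro rfl; rfl
    · intro hjm
      exact (hinjG (mem_coe.2 hj) (mem_coe.2 hm) hjm).symm

/-- **The converse embedding loses nothing**: flags in the stub's normal form are projective flags
(`a ↦ (1, a)`, `b ↦ (-1, b)`: `(-1, b) ⬝ᵥ (1, a) = a ⬝ᵥ b - 1`).  So `T(q) ≤ SRS(q) ≤ T(q) + 2`.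
[elementary] -/
theorem projective_srs_of_stub_srs [DecidableEq F] (S : Finset ((Fin 2 → F) × (Fin 2 → F)))
    (hS : ∀ f ∈ S, ∀ f' ∈ S, (f.1 ⬝ᵥ f'.2 = 1 ↔ f = f')) :
    ∃ x l : S → Fin 3 → F, ∀ i j, l i ⬝ᵥ x j = 0 ↔ i = j := by
  refine ⟨fun f => ![1, f.1.1 0, f.1.1 1], fun f => ![-1, f.1.2 0, f.1.2 1], ?_⟩
  rintro ⟨f, hf⟩ ⟨f', hf'⟩
  have key : ![-1, f.2 0, f.2 1] ⬝ᵥ ![1, f'.1 0, f'.1 1] = f'.1 ⬝ᵥ f.2 - 1 := by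
    rw [vec3_dotProduct, vec2_dotProduct]
    simp
    ring
  rw [key, sub_eq_zero, hS f' hf' f hf, Subtype.mk.injEq]
  exact eq_comm


/-! ## Trace coordinates: flags of `PG(2,F) = ℙ(L)` for a cubic extension `L / F`, and the cyclic
(Singer) unital substitute -/

section Trace

variable [DecidableEq F] {L : Type*} [Field L] [Algebra F L] [FiniteDimensional F L]

/-- **Flags in trace coordinates.**  Let `L ⊇ F` be a field with `[L : F] = 3`, so that
`ℙ_F(L) = PG(2,F)` with lines the kernels of the functionals `Tr_{L/F}(λ ·)`.  Families of points
`x_j ∈ L` and line-functionals `λ_i ∈ L` with `Tr(λ_i x_j) = 0 ↔ i = j` give flags in the stub's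
normal form with two lost (`stub_srs_of_projective_srs` in the coordinates of any `F`-basis `b` of
`L`: point `j ↦ b.repr x_j`, line `i ↦ (Tr(λ_i b_k))_k`, and `Σ_k Tr(λ_i b_k)·(x_j)_k = Tr(λ_i x_j)`).
This is the form in which cyclic (Singer-invariant) systems — the prime-field "unital substitute" of
the siege plan (DECOMPOSITIONS.md §2.U1–U2) — are produced. [folklore] -/
theorem stub_srs_of_traceFlags (h3 : Module.finrank F L = 3) {ι : Type*} [Fintype ι]
    [DecidableEq ι] (x lam : ι → L)
    (h : ∀ i j, Algebra.trace F L (lam i * x j) = 0 ↔ i = j) :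
    ∃ S : Finset ((Fin 2 → F) × (Fin 2 → F)), Fintype.card ι ≤ S.card + 2 ∧
      ∀ f ∈ S, ∀ f' ∈ S, (f.1 ⬝ᵥ f'.2 = 1 ↔ f = f') := by
  classical
  let b := Module.finBasisOfFinrankEq F L h3
  refine stub_srs_of_projective_srs (fun j => (b.repr (x j) : Fin 3 → F))
    (fun i k => Algebra.trace F L (lam i * b k)) fun i j => ?_
  rw [← h i j]
  suffices hdot : (fun k => Algebra.trace F L (lam i * b k)) ⬝ᵥ (b.repr (x j) : Fin 3 → F)
      = Algebra.trace F L (lam i * x j) by rw [hdot]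
  have hx : x j = ∑ k, (b.repr (x j)) k • b k := (b.sum_repr (x j)).symm
  conv_rhs => rw [hx, Finset.mul_sum, map_sum]
  simp only [dotProduct, mul_smul_comm, map_smul, smul_eq_mul]
  refine Finset.sum_congr rfl fun k _ => ?_
  ring

/-- **The cyclic (Singer) unital substitute.**  With `L / F` cubic as above, let `K ≤ Lˣ` be a
finite subgroup and `μ ∈ L` such that `μ·w` has trace zero for exactly one `w ∈ K`, namely `w = 1`
("a coset of `K` meets the trace-zero plane — the line `D` of the cyclic model — in exactly one
point": the one-coset criterion SINGER1 of the siege plan).  Then the `K`-orbit of the flag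
(point `1`, line `ker Tr(μ ·)`) is a strong representative system of `PG(2,F)` of size `|K|`
(point `u`, line `ker Tr(μ u⁻¹ ·)`: incidence `Tr(μ u⁻¹ u') = 0 ↔ u⁻¹u' = 1`), hence
`|K| ≤ |S| + 2` flags in the stub's normal form (`stub_srs_of_traceFlags`).  Over `F = ZMod p`,
`L = 𝔽_{p³}`, `K` = the subgroup of order `m ∣ p²+p+1` (modulo `𝔽_pˣ`), this is the construction
behind the ISW-tight cyclic semioval of `PG(2,7)` (`m = 19`, so `T(7) ≥ 17`) and, orbit by orbit,
the record `T(11) ≥ 33` (multicoset, `m = 7`); asymptotically it needs a divisor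
`m ∈ [c·p^{3/2}, p^{3/2}+1]` of `p²+p+1` AND the alignment of `≈ √p` cubic Gauss-sum phases, which is
why it is a sporadic witness generator and not a proof of the stub. [folklore] -/
theorem stub_srs_of_singer (h3 : Module.finrank F L = 3) (K : Subgroup Lˣ) [Fintype K] (μ : L)
    (hK : ∀ w ∈ K, Algebra.trace F L (μ * (w : Lˣ)) = 0 ↔ w = 1) :
    ∃ S : Finset ((Fin 2 → F) × (Fin 2 → F)), Fintype.card K ≤ S.card + 2 ∧
      ∀ f ∈ S, ∀ f' ∈ S, (f.1 ⬝ᵥ f'.2 = 1 ↔ f = f') := by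
  classical
  refine stub_srs_of_traceFlags h3 (fun w : K => ((w : Lˣ) : L))
    (fun w : K => μ * (((w : Lˣ)⁻¹ : Lˣ) : L)) fun i j => ?_
  have hmem : (i : Lˣ)⁻¹ * (j : Lˣ) ∈ K := K.mul_mem (K.inv_mem i.2) j.2
  have h1 : μ * (((i : Lˣ)⁻¹ : Lˣ) : L) * ((j : Lˣ) : L) = μ * (((i : Lˣ)⁻¹ * (j : Lˣ) : Lˣ) : L) := by
    rw [Units.val_mul, mul_assoc]
  rw [h1, hK _ hmem, inv_mul_eq_one, Subtype.ext_iff]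

end Trace

/-! ## The multicoset (prescribed Singer symmetry) form — appended 2026-08-16, same seat -/

section Multicoset

variable [DecidableEq F] {L : Type*} [Field L] [Algebra F L] [FiniteDimensional F L]

/-- **Multicoset criterion** (DECOMPOSITIONS.md §2.U2, the generator of the record `SRS(11) ≥ 35`):
with `L / F` cubic, `K ≤ Lˣ` a finite subgroup, and for each label `s ∈ J` a point representative
`μ_s ∈ L` and a shift `σ_s ∈ Lˣ`, suppose
`Tr(μ_s σ_s σ_{s'}⁻¹ w) = 0 ↔ (s = s' ∧ w = 1)` for all `s, s' ∈ J`, `w ∈ K`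
(diagonal `s = s'`: the coset `μ_s K` meets the trace-zero plane exactly in `μ_s`; off-diagonal: the
coset `μ_s σ_s σ_{s'}⁻¹ K` misses it).  Then the points `μ_s σ_s u` and line-functionals
`σ_{s'}⁻¹ u'⁻¹` (`u, u' ∈ K`) form a strong representative system of `PG(2,F)` of size `|J|·|K|`,
hence `|J|·|K| ≤ |S| + 2` flags in the stub's normal form (`stub_srs_of_traceFlags`).  `|J| = 1`,
`σ = 1` is `stub_srs_of_singer`. [folklore] -/
theorem stub_srs_of_singer_multicoset (h3 : Module.finrank F L = 3) (K : Subgroup Lˣ) [Fintype K]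
    {J : Type*} [Fintype J] [DecidableEq J] (μ : J → L) (σ : J → Lˣ)
    (hK : ∀ s s' : J, ∀ w ∈ K,
      Algebra.trace F L (μ s * (σ s : L) * ((σ s')⁻¹ : Lˣ) * (w : Lˣ)) = 0 ↔ (s = s' ∧ w = 1)) :
    ∃ S : Finset ((Fin 2 → F) × (Fin 2 → F)), Fintype.card J * Fintype.card K ≤ S.card + 2 ∧
      ∀ f ∈ S, ∀ f' ∈ S, (f.1 ⬝ᵥ f'.2 = 1 ↔ f = f') := by
  classical
  have h := stub_srs_of_traceFlags h3 (ι := J × K)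
    (fun j => μ j.1 * (σ j.1 : L) * ((j.2 : Lˣ) : L))
    (fun i => (((σ i.1)⁻¹ : Lˣ) : L) * (((i.2 : Lˣ)⁻¹ : Lˣ) : L)) ?_
  · simpa only [Fintype.card_prod] using h
  rintro ⟨s', u'⟩ ⟨s, u⟩
  have hmem : (u : Lˣ) * (u' : Lˣ)⁻¹ ∈ K := K.mul_mem u.2 (K.inv_mem u'.2)
  have h1 : (((σ s')⁻¹ : Lˣ) : L) * (((u' : Lˣ)⁻¹ : Lˣ) : L) * (μ s * (σ s : L) * ((u : Lˣ) : L))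
      = μ s * (σ s : L) * ((σ s')⁻¹ : Lˣ) * (((u : Lˣ) * (u' : Lˣ)⁻¹ : Lˣ) : L) := by
    rw [Units.val_mul]
    ring
  rw [h1, hK s s' _ hmem, mul_inv_eq_one, Prod.mk.injEq]
  constructor
  · rintro ⟨rfl, h2⟩
    exact ⟨rfl, (Subtype.ext h2).symm⟩
  · rintro ⟨rfl, h2⟩
    exact ⟨rfl, congrArg Subtype.val h2.symm⟩

end Multicoset

end Summit.MatrixMultiplication.MatrixMultiplication.Theorems.LevelOneGL2Designs.ProjectiveChart
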